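import Summits.ValiantsHypothesis.ValiantsHypothesis.Theorems.LacunarySymmetroidMatrixDescartesPivotResolventEnvelope
import Summits.ValiantsHypothesis.ValiantsHypothesis.Theorems.LacunarySymmetroidMatrixDescartesPivotRankOneResolventPairForm

/-!
# `MatrixDescartes` census — rank-one `(2,4)₁`: the ENVELOPE LAW for the four-letter pencil in hyperbolic normal form
# (the profile falls at `x` iff `∑ₖ (dₖ − e) wₖ x^{dₖ} (vₖ₀C − vₖ₁√(AC))² < 0` — the slope is the `p̂`-mean of `dₖ − e`)

HONEST FRAMING.  Object-search cell `pub-symmetroid`, seat `val-sym-mdr-p1` (generation 19); helper file `--supports` the crux item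
stmt-ValiantsHypothesis-18050 (`Theses.LacunarySymmetroid.MatrixDescartes`, OPEN, on HOLD) with NO closure claim.  Companion of
`…PivotResolventEnvelope` (same seat: the envelope identity for general symmetric `J`, the voting cubics, the chamber-(C) bands), here
INSTANTIATED on the explicit four-letter pencil `X^e J + ∑ₖ wₖX^{dₖ}vₖvₖᵀ` with `J = [[0,1],[1,0]]` in the moment-polynomial conventions of
`…PivotRankOneResolventPairForm` (`𝔄, 𝔘, ℭ, τ = −2𝔘, π = 𝔄ℭ − 𝔘²`): **`normalForm_deriv_sign`** — with `R = R(x)` the resolvent and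
`sₖ = vₖ₀C(x) − vₖ₁(R + U(x))` (`R + U = √(AC)`; `sₖ` is letter `k` seen from the kernel direction `z = (C, −(R+U))` of `RJ + G(x)`), the
profile `R/x^e` FALLS at `x > 0` if `∑ₖ (dₖ − e)·wₖx^{dₖ}·sₖ² < 0` and RISES if it is `> 0` (any real weights; `C(x) > 0` and positive
discriminant assumed).  Dividing by `A·C` gives the RMS form `sign Θ′ = sign ∑ₖ (dₖ − e)aₖ(g − tₖ)²`, `g = √(C/A)`, `tₖ = vₖ₁/vₖ₀`, to which
`voting_identity_rms` and the band lemmas of the companion file apply: on the `1|3` split every turning point needs letter `0`'s weighted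
square to balance the three upper ones, and in chamber (C) letters `2, 3` can help only inside their bands.  Nothing here bears on
`MatrixDescartes` in its window, on `DoorA26` / `DoorA34`, registers / credences, or `VP ≠ VNP`; the rank-one register is unchanged.

[folklore] Elementary; the tree lemmas named above.  No definitions, no named facts.
-/

-- `Summit.ValiantsHypothesis.ValiantsHypothesis.…` repeats a component by the D-0017 layout
-- (single-conjunct summit), which the `dupNamespace` linter flags; the name is mandated.
set_option linter.dupNamespace false

namespace Summit.ValiantsHypothesis.ValiantsHypothesis.Theorems.LacunarySymmetroidMatrixDescartes.Pivot.Resolvent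

open Polynomial Set
open scoped BigOperators

/-! ## The four-letter pencil in hyperbolic normal form -/

/-- **ENVELOPE LAW, hyperbolic normal form** (`J = [[0,1],[1,0]]`, four rank-one letters `wₖX^{dₖ}vₖvₖᵀ`, any real weights with
`C(x) > 0` and positive discriminant at `x > 0`).  With `A, U, C` the entries of `G(x)`, `R = R(x) = (τ(x) + S(x))/2` the resolvent
(`τ = −2U`, `S² = τ² + 4π`, so `R + U = √(AC)`) and `sₖ := vₖ₀·C(x) − vₖ₁·(R + U(x))` the letters seen from the kernel direction
`z = (C, −(R+U))`: the profile `R/x^e` FALLS at `x` if `∑ₖ (dₖ − e) wₖ x^{dₖ} sₖ² < 0` and RISES at `x` if `∑ₖ (dₖ − e) wₖ x^{dₖ} sₖ² > 0`.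
(Dividing by `C·A`: `sₖ² ∝ vₖ₀²(g − tₖ)²`, `g = √(C/A)`, `tₖ = vₖ₁/vₖ₀` — the RMS form of `voting_identity_rms`.) [this file] -/
theorem normalForm_deriv_sign (e d₀ d₁ d₂ d₃ : ℕ) (v₀ v₁ v₂ v₃ : Fin 2 → ℝ) (w₀ w₁ w₂ w₃ : ℝ) (𝔄 𝔘 ℭ τ π : ℝ[X])
    (h𝔄 : 𝔄 = Polynomial.C (w₀ * v₀ 0 ^ 2) * X ^ d₀ + Polynomial.C (w₁ * v₁ 0 ^ 2) * X ^ d₁ + Polynomial.C (w₂ * v₂ 0 ^ 2) * X ^ d₂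
      + Polynomial.C (w₃ * v₃ 0 ^ 2) * X ^ d₃)
    (h𝔘 : 𝔘 = Polynomial.C (w₀ * (v₀ 0 * v₀ 1)) * X ^ d₀ + Polynomial.C (w₁ * (v₁ 0 * v₁ 1)) * X ^ d₁
      + Polynomial.C (w₂ * (v₂ 0 * v₂ 1)) * X ^ d₂ + Polynomial.C (w₃ * (v₃ 0 * v₃ 1)) * X ^ d₃)
    (hℭ : ℭ = Polynomial.C (w₀ * v₀ 1 ^ 2) * X ^ d₀ + Polynomial.C (w₁ * v₁ 1 ^ 2) * X ^ d₁ + Polynomial.C (w₂ * v₂ 1 ^ 2) * X ^ d₂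
      + Polynomial.C (w₃ * v₃ 1 ^ 2) * X ^ d₃)
    (hτ : τ = Polynomial.C (0 : ℝ) * ℭ - Polynomial.C (2 * 1) * 𝔘 + Polynomial.C (0 : ℝ) * 𝔄) (hπ : π = 𝔄 * ℭ - 𝔘 ^ 2)
    (x : ℝ) (hx : 0 < x) (hC : 0 < ℭ.eval x) (hdisc : 0 < (τ.eval x) ^ 2 + 4 * 1 * π.eval x)
    (R : ℝ) (hR : R = (τ.eval x + Real.sqrt ((τ.eval x) ^ 2 + 4 * 1 * π.eval x)) / (2 * 1)) :
    ((((d₀ : ℝ) - e) * (w₀ * x ^ d₀) * (v₀ 0 * ℭ.eval x - v₀ 1 * (R + 𝔘.eval x)) ^ 2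
        + ((d₁ : ℝ) - e) * (w₁ * x ^ d₁) * (v₁ 0 * ℭ.eval x - v₁ 1 * (R + 𝔘.eval x)) ^ 2
        + ((d₂ : ℝ) - e) * (w₂ * x ^ d₂) * (v₂ 0 * ℭ.eval x - v₂ 1 * (R + 𝔘.eval x)) ^ 2
        + ((d₃ : ℝ) - e) * (w₃ * x ^ d₃) * (v₃ 0 * ℭ.eval x - v₃ 1 * (R + 𝔘.eval x)) ^ 2 < 0) →
      deriv (fun y => ((τ.eval y + Real.sqrt ((τ.eval y) ^ 2 + 4 * 1 * π.eval y)) / (2 * 1)) / y ^ e) x < 0)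
    ∧ ((0 < ((d₀ : ℝ) - e) * (w₀ * x ^ d₀) * (v₀ 0 * ℭ.eval x - v₀ 1 * (R + 𝔘.eval x)) ^ 2
        + ((d₁ : ℝ) - e) * (w₁ * x ^ d₁) * (v₁ 0 * ℭ.eval x - v₁ 1 * (R + 𝔘.eval x)) ^ 2
        + ((d₂ : ℝ) - e) * (w₂ * x ^ d₂) * (v₂ 0 * ℭ.eval x - v₂ 1 * (R + 𝔘.eval x)) ^ 2
        + ((d₃ : ℝ) - e) * (w₃ * x ^ d₃) * (v₃ 0 * ℭ.eval x - v₃ 1 * (R + 𝔘.eval x)) ^ 2) →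
      0 < deriv (fun y => ((τ.eval y + Real.sqrt ((τ.eval y) ^ 2 + 4 * 1 * π.eval y)) / (2 * 1)) / y ^ e) x) := by
  -- values and tilts of the moment polynomials at `x`
  have eA := eval_fourNomial (w₀ * v₀ 0 ^ 2) (w₁ * v₁ 0 ^ 2) (w₂ * v₂ 0 ^ 2) (w₃ * v₃ 0 ^ 2) x d₀ d₁ d₂ d₃
  have eU := eval_fourNomial (w₀ * (v₀ 0 * v₀ 1)) (w₁ * (v₁ 0 * v₁ 1)) (w₂ * (v₂ 0 * v₂ 1)) (w₃ * (v₃ 0 * v₃ 1)) x d₀ d₁ d₂ d₃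
  have eC := eval_fourNomial (w₀ * v₀ 1 ^ 2) (w₁ * v₁ 1 ^ 2) (w₂ * v₂ 1 ^ 2) (w₃ * v₃ 1 ^ 2) x d₀ d₁ d₂ d₃
  have dA := x_mul_eval_derivative_fourNomial (w₀ * v₀ 0 ^ 2) (w₁ * v₁ 0 ^ 2) (w₂ * v₂ 0 ^ 2) (w₃ * v₃ 0 ^ 2) x d₀ d₁ d₂ d₃
  have dU := x_mul_eval_derivative_fourNomial (w₀ * (v₀ 0 * v₀ 1)) (w₁ * (v₁ 0 * v₁ 1)) (w₂ * (v₂ 0 * v₂ 1)) (w₃ * (v₃ 0 * v₃ 1)) x d₀ d₁ d₂ d₃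
  have dC := x_mul_eval_derivative_fourNomial (w₀ * v₀ 1 ^ 2) (w₁ * v₁ 1 ^ 2) (w₂ * v₂ 1 ^ 2) (w₃ * v₃ 1 ^ 2) x d₀ d₁ d₂ d₃
  rw [← h𝔄] at dA eA
  rw [← h𝔘] at dU eU
  rw [← hℭ] at dC eC
  have hτx : τ.eval x = 0 * ℭ.eval x - 2 * 1 * 𝔘.eval x + 0 * 𝔄.eval x := by
    rw [hτ]; simp only [eval_add, eval_sub, eval_mul, eval_C]
  have hπx : π.eval x = 𝔄.eval x * ℭ.eval x - 𝔘.eval x ^ 2 := by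
    rw [hπ]; simp only [eval_sub, eval_mul, eval_pow]
  have hτe : x * τ.derivative.eval x - e * τ.eval x
      = 0 * (x * ℭ.derivative.eval x - e * ℭ.eval x) - 2 * 1 * (x * 𝔘.derivative.eval x - e * 𝔘.eval x)
        + 0 * (x * 𝔄.derivative.eval x - e * 𝔄.eval x) := by
    rw [hτ]
    simp only [derivative_add, derivative_sub, derivative_mul, derivative_C, zero_mul, zero_add, eval_add, eval_sub, eval_mul, eval_C]
    ring
  have hπe : x * π.derivative.eval x - 2 * e * π.eval x
      = (x * 𝔄.derivative.eval x - e * 𝔄.eval x) * ℭ.eval x + 𝔄.eval x * (x * ℭ.derivative.eval x - e * ℭ.eval x)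
        - 2 * 𝔘.eval x * (x * 𝔘.derivative.eval x - e * 𝔘.eval x) := by
    rw [hπ]
    simp only [derivative_sub, derivative_mul, derivative_pow, eval_add, eval_sub, eval_mul, eval_pow, eval_C, Nat.cast_ofNat,
      Nat.add_one_sub_one, pow_one]
    ring
  have hδ : (1 : ℝ) = 1 ^ 2 - 0 * 0 := by norm_num
  -- kernel direction `z = (C, −(R+U))` and its `J`-sign: `−zᵀJz = 2C(R+U)`, `R + U = S/2 > 0`
  set S := Real.sqrt ((τ.eval x) ^ 2 + 4 * 1 * π.eval x) with hSdef
  have hSpos : 0 < S := Real.sqrt_pos.2 hdisc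
  have hRU : R + 𝔘.eval x = S / 2 := by rw [hR, hτx]; ring
  have hz : 0 < -(0 * (R * 0 + ℭ.eval x) ^ 2 + 2 * 1 * ((R * 0 + ℭ.eval x) * (-(R * 1 + 𝔘.eval x)))
      + 0 * (-(R * 1 + 𝔘.eval x)) ^ 2) := by
    have hid : -(0 * (R * 0 + ℭ.eval x) ^ 2 + 2 * 1 * ((R * 0 + ℭ.eval x) * (-(R * 1 + 𝔘.eval x)))
        + 0 * (-(R * 1 + 𝔘.eval x)) ^ 2) = ℭ.eval x * S := by rw [show R * 1 + 𝔘.eval x = S / 2 by rw [mul_one]; exact hRU]; ring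
    rw [hid]; exact mul_pos hC hSpos
  have key := deriv_resolventProfile_sign_envelope 1 e τ π x one_pos hx hdisc 0 1 0 (𝔄.eval x) (𝔘.eval x) (ℭ.eval x)
    (x * 𝔄.derivative.eval x - e * 𝔄.eval x) (x * 𝔘.derivative.eval x - e * 𝔘.eval x) (x * ℭ.derivative.eval x - e * ℭ.eval x)
    R (R * 0 + ℭ.eval x) (-(R * 1 + 𝔘.eval x)) hδ hτx hπx hτe hπe hR rfl rfl hz
  -- the quadratic form of `G_e` along `z` is the letter sum
  have hQ := quadForm_letters ((d₀ : ℝ) - e) ((d₁ : ℝ) - e) ((d₂ : ℝ) - e) ((d₃ : ℝ) - e) (w₀ * x ^ d₀) (w₁ * x ^ d₁) (w₂ * x ^ d₂)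
    (w₃ * x ^ d₃) (v₀ 0) (v₀ 1) (v₁ 0) (v₁ 1) (v₂ 0) (v₂ 1) (v₃ 0) (v₃ 1) (R * 0 + ℭ.eval x) (-(R * 1 + 𝔘.eval x))
    (x * 𝔄.derivative.eval x - e * 𝔄.eval x) (x * 𝔘.derivative.eval x - e * 𝔘.eval x) (x * ℭ.derivative.eval x - e * ℭ.eval x)
    (by rw [dA, eA]; ring) (by rw [dU, eU]; ring) (by rw [dC, eC]; ring)
  have hs : ∀ (p q : ℝ), p * (R * 0 + ℭ.eval x) + q * (-(R * 1 + 𝔘.eval x)) = p * ℭ.eval x - q * (R + 𝔘.eval x) := by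
    intro p q; ring
  rw [hs, hs, hs, hs] at hQ
  rw [hQ] at key
  exact key

/-! ## The product form of the critical polynomial (appended, same seat)

The critical polynomial `Φ = δπ_e² + ττ_eπ_e − πτ_e²` of `…PivotResolventRolle` FACTORS through the two roots `R, R₂ = (τ ± S)/(2δ)` of the
resolvent quadratic (Vieta): `Φ = δ·(Rτ_e + π_e)·(R₂τ_e + π_e)` — the product of the slope numerators of the positive branch `R/x^e` and
of the negative branch `R₂/x^e`.  In hyperbolic normal form each factor is a `(dₖ − e)`-signed sum of squares (the envelope law for either
kernel direction), so `C(x)²·Φ(x) = [∑ₖ εₖaₖsₖ²]·[∑ₖ εₖaₖ(sₖ⁺)²]` with `sₖ = vₖ₀C − vₖ₁(R+U)`, `sₖ⁺ = vₖ₀C − vₖ₁(R₂+U)` (`R + U = √(AC) = −(R₂+U)`):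
the zeros of `Φ` are exactly the turning points of the two profiles (g18 memo §1, now algebraic). -/

/-- **VIETA PRODUCT FORM.**  With `S² = τ² + 4δπ`, `δ ≠ 0`, `R = (τ+S)/(2δ)`, `R₂ = (τ−S)/(2δ)`:
`δπ_e² + ττ_eπ_e − πτ_e² = δ(Rτ_e + π_e)(R₂τ_e + π_e)`. [folklore] -/
theorem criticalValue_eq_mul (δ τ π τe πe S : ℝ) (hδ : δ ≠ 0) (hS : S ^ 2 = τ ^ 2 + 4 * δ * π) :
    δ * πe ^ 2 + τ * τe * πe - π * τe ^ 2
      = δ * ((τ + S) / (2 * δ) * τe + πe) * ((τ - S) / (2 * δ) * τe + πe) := by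
  have hsum : τ - δ * ((τ + S) / (2 * δ) + (τ - S) / (2 * δ)) = 0 := by field_simp; ring
  have hprod : -π - δ * ((τ + S) / (2 * δ) * ((τ - S) / (2 * δ))) = 0 := by
    field_simp
    linear_combination hS
  linear_combination (τe * πe) * hsum + τe ^ 2 * hprod

/-- Raw evaluation of the critical polynomial: `Φ(x) = δ·π_e(x)² + τ(x)τ_e(x)π_e(x) − π(x)τ_e(x)²` with `τ_e(x) = xτ′(x) − eτ(x)`,
`π_e(x) = xπ′(x) − 2eπ(x)`, `δ = J₀₁² − J₀₀J₁₁`. [tree: definition of `Φ` in `…PivotResolventRolle`] -/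
theorem eval_criticalPoly_raw (e : ℕ) (J : Matrix (Fin 2) (Fin 2) ℝ) (τ π Φ : ℝ[X])
    (hΦ : Φ = Polynomial.C (J 0 1 ^ 2 - J 0 0 * J 1 1) * (X * π.derivative - Polynomial.C (2 * (e : ℝ)) * π) ^ 2
        + τ * (X * τ.derivative - Polynomial.C (e : ℝ) * τ) * (X * π.derivative - Polynomial.C (2 * (e : ℝ)) * π)
        - π * (X * τ.derivative - Polynomial.C (e : ℝ) * τ) ^ 2) (x : ℝ) :
    Φ.eval x = (J 0 1 ^ 2 - J 0 0 * J 1 1) * (x * π.derivative.eval x - 2 * e * π.eval x) ^ 2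
      + τ.eval x * (x * τ.derivative.eval x - e * τ.eval x) * (x * π.derivative.eval x - 2 * e * π.eval x)
      - π.eval x * (x * τ.derivative.eval x - e * τ.eval x) ^ 2 := by
  subst hΦ
  simp only [eval_add, eval_sub, eval_mul, eval_pow, eval_C, eval_X]

/-- **PRODUCT FORM OF THE CRITICAL POLYNOMIAL (general symmetric `J`, `δ > 0`, non-negative discriminant at `x`).**
`Φ(x) = δ·(R(x)τ_e(x) + π_e(x))·(R₂(x)τ_e(x) + π_e(x))`, `R, R₂ = (τ(x) ± S(x))/(2δ)`: the zeros of `Φ` are the turning points of the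
positive-branch profile together with those of the negative branch. [this file] -/
theorem criticalPoly_eval_eq_mul (e : ℕ) (J : Matrix (Fin 2) (Fin 2) ℝ) (τ π Φ : ℝ[X])
    (hΦ : Φ = Polynomial.C (J 0 1 ^ 2 - J 0 0 * J 1 1) * (X * π.derivative - Polynomial.C (2 * (e : ℝ)) * π) ^ 2
        + τ * (X * τ.derivative - Polynomial.C (e : ℝ) * τ) * (X * π.derivative - Polynomial.C (2 * (e : ℝ)) * π)
        - π * (X * τ.derivative - Polynomial.C (e : ℝ) * τ) ^ 2) (x : ℝ) (hδ : 0 < J 0 1 ^ 2 - J 0 0 * J 1 1)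
    (hdisc : 0 ≤ (τ.eval x) ^ 2 + 4 * (J 0 1 ^ 2 - J 0 0 * J 1 1) * π.eval x) :
    Φ.eval x = (J 0 1 ^ 2 - J 0 0 * J 1 1)
      * ((τ.eval x + Real.sqrt ((τ.eval x) ^ 2 + 4 * (J 0 1 ^ 2 - J 0 0 * J 1 1) * π.eval x)) / (2 * (J 0 1 ^ 2 - J 0 0 * J 1 1))
          * (x * τ.derivative.eval x - e * τ.eval x) + (x * π.derivative.eval x - 2 * e * π.eval x))
      * ((τ.eval x - Real.sqrt ((τ.eval x) ^ 2 + 4 * (J 0 1 ^ 2 - J 0 0 * J 1 1) * π.eval x)) / (2 * (J 0 1 ^ 2 - J 0 0 * J 1 1))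
          * (x * τ.derivative.eval x - e * τ.eval x) + (x * π.derivative.eval x - 2 * e * π.eval x)) := by
  rw [eval_criticalPoly_raw e J τ π Φ hΦ x]
  exact criticalValue_eq_mul _ _ _ _ _ _ hδ.ne' (Real.sq_sqrt hdisc)

/-- **SOS PRODUCT FORM, hyperbolic normal form.**  For the four-letter pencil with `J = [[0,1],[1,0]]` (conventions of
`normalForm_deriv_sign`; `Φ` the critical polynomial), at every `x` with non-negative discriminant:
`C(x)²·Φ(x) = [∑ₖ (dₖ − e)wₖx^{dₖ}sₖ²]·[∑ₖ (dₖ − e)wₖx^{dₖ}(sₖ⁺)²]`, `sₖ = vₖ₀C − vₖ₁(R + U)`, `sₖ⁺ = vₖ₀C − vₖ₁(R₂ + U)`,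
`R, R₂ = (τ(x) ± S(x))/2`. [this file] -/
theorem normalForm_criticalPoly_eval_eq_sos_mul (e d₀ d₁ d₂ d₃ : ℕ) (v₀ v₁ v₂ v₃ : Fin 2 → ℝ) (w₀ w₁ w₂ w₃ : ℝ) (𝔄 𝔘 ℭ τ π Φ : ℝ[X])
    (h𝔄 : 𝔄 = Polynomial.C (w₀ * v₀ 0 ^ 2) * X ^ d₀ + Polynomial.C (w₁ * v₁ 0 ^ 2) * X ^ d₁ + Polynomial.C (w₂ * v₂ 0 ^ 2) * X ^ d₂
      + Polynomial.C (w₃ * v₃ 0 ^ 2) * X ^ d₃)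
    (h𝔘 : 𝔘 = Polynomial.C (w₀ * (v₀ 0 * v₀ 1)) * X ^ d₀ + Polynomial.C (w₁ * (v₁ 0 * v₁ 1)) * X ^ d₁
      + Polynomial.C (w₂ * (v₂ 0 * v₂ 1)) * X ^ d₂ + Polynomial.C (w₃ * (v₃ 0 * v₃ 1)) * X ^ d₃)
    (hℭ : ℭ = Polynomial.C (w₀ * v₀ 1 ^ 2) * X ^ d₀ + Polynomial.C (w₁ * v₁ 1 ^ 2) * X ^ d₁ + Polynomial.C (w₂ * v₂ 1 ^ 2) * X ^ d₂
      + Polynomial.C (w₃ * v₃ 1 ^ 2) * X ^ d₃)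
    (hτ : τ = Polynomial.C (0 : ℝ) * ℭ - Polynomial.C (2 * 1) * 𝔘 + Polynomial.C (0 : ℝ) * 𝔄) (hπ : π = 𝔄 * ℭ - 𝔘 ^ 2)
    (hΦ : Φ = Polynomial.C ((1 : ℝ) ^ 2 - 0 * 0) * (X * π.derivative - Polynomial.C (2 * (e : ℝ)) * π) ^ 2
        + τ * (X * τ.derivative - Polynomial.C (e : ℝ) * τ) * (X * π.derivative - Polynomial.C (2 * (e : ℝ)) * π)
        - π * (X * τ.derivative - Polynomial.C (e : ℝ) * τ) ^ 2)
    (x : ℝ) (hdisc : 0 ≤ (τ.eval x) ^ 2 + 4 * 1 * π.eval x) (R R₂ : ℝ)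
    (hR : R = (τ.eval x + Real.sqrt ((τ.eval x) ^ 2 + 4 * 1 * π.eval x)) / (2 * 1))
    (hR₂ : R₂ = (τ.eval x - Real.sqrt ((τ.eval x) ^ 2 + 4 * 1 * π.eval x)) / (2 * 1)) :
    (ℭ.eval x) ^ 2 * Φ.eval x
      = (((d₀ : ℝ) - e) * (w₀ * x ^ d₀) * (v₀ 0 * ℭ.eval x - v₀ 1 * (R + 𝔘.eval x)) ^ 2
          + ((d₁ : ℝ) - e) * (w₁ * x ^ d₁) * (v₁ 0 * ℭ.eval x - v₁ 1 * (R + 𝔘.eval x)) ^ 2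
          + ((d₂ : ℝ) - e) * (w₂ * x ^ d₂) * (v₂ 0 * ℭ.eval x - v₂ 1 * (R + 𝔘.eval x)) ^ 2
          + ((d₃ : ℝ) - e) * (w₃ * x ^ d₃) * (v₃ 0 * ℭ.eval x - v₃ 1 * (R + 𝔘.eval x)) ^ 2)
        * (((d₀ : ℝ) - e) * (w₀ * x ^ d₀) * (v₀ 0 * ℭ.eval x - v₀ 1 * (R₂ + 𝔘.eval x)) ^ 2
          + ((d₁ : ℝ) - e) * (w₁ * x ^ d₁) * (v₁ 0 * ℭ.eval x - v₁ 1 * (R₂ + 𝔘.eval x)) ^ 2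
          + ((d₂ : ℝ) - e) * (w₂ * x ^ d₂) * (v₂ 0 * ℭ.eval x - v₂ 1 * (R₂ + 𝔘.eval x)) ^ 2
          + ((d₃ : ℝ) - e) * (w₃ * x ^ d₃) * (v₃ 0 * ℭ.eval x - v₃ 1 * (R₂ + 𝔘.eval x)) ^ 2) := by
  -- values and tilts of the moment polynomials at `x`
  have eA := eval_fourNomial (w₀ * v₀ 0 ^ 2) (w₁ * v₁ 0 ^ 2) (w₂ * v₂ 0 ^ 2) (w₃ * v₃ 0 ^ 2) x d₀ d₁ d₂ d₃
  have eU := eval_fourNomial (w₀ * (v₀ 0 * v₀ 1)) (w₁ * (v₁ 0 * v₁ 1)) (w₂ * (v₂ 0 * v₂ 1)) (w₃ * (v₃ 0 * v₃ 1)) x d₀ d₁ d₂ d₃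
  have eC := eval_fourNomial (w₀ * v₀ 1 ^ 2) (w₁ * v₁ 1 ^ 2) (w₂ * v₂ 1 ^ 2) (w₃ * v₃ 1 ^ 2) x d₀ d₁ d₂ d₃
  have dA := x_mul_eval_derivative_fourNomial (w₀ * v₀ 0 ^ 2) (w₁ * v₁ 0 ^ 2) (w₂ * v₂ 0 ^ 2) (w₃ * v₃ 0 ^ 2) x d₀ d₁ d₂ d₃
  have dU := x_mul_eval_derivative_fourNomial (w₀ * (v₀ 0 * v₀ 1)) (w₁ * (v₁ 0 * v₁ 1)) (w₂ * (v₂ 0 * v₂ 1)) (w₃ * (v₃ 0 * v₃ 1)) x d₀ d₁ d₂ d₃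
  have dC := x_mul_eval_derivative_fourNomial (w₀ * v₀ 1 ^ 2) (w₁ * v₁ 1 ^ 2) (w₂ * v₂ 1 ^ 2) (w₃ * v₃ 1 ^ 2) x d₀ d₁ d₂ d₃
  rw [← h𝔄] at dA eA
  rw [← h𝔘] at dU eU
  rw [← hℭ] at dC eC
  have hτx : τ.eval x = 0 * ℭ.eval x - 2 * 1 * 𝔘.eval x + 0 * 𝔄.eval x := by
    rw [hτ]; simp only [eval_add, eval_sub, eval_mul, eval_C]
  have hπx : π.eval x = 𝔄.eval x * ℭ.eval x - 𝔘.eval x ^ 2 := by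
    rw [hπ]; simp only [eval_sub, eval_mul, eval_pow]
  have hτe : x * τ.derivative.eval x - e * τ.eval x
      = 0 * (x * ℭ.derivative.eval x - e * ℭ.eval x) - 2 * 1 * (x * 𝔘.derivative.eval x - e * 𝔘.eval x)
        + 0 * (x * 𝔄.derivative.eval x - e * 𝔄.eval x) := by
    rw [hτ]
    simp only [derivative_add, derivative_sub, derivative_mul, derivative_C, zero_mul, zero_add, eval_add, eval_sub, eval_mul, eval_C]
    ring
  have hπe : x * π.derivative.eval x - 2 * e * π.eval x
      = (x * 𝔄.derivative.eval x - e * 𝔄.eval x) * ℭ.eval x + 𝔄.eval x * (x * ℭ.derivative.eval x - e * ℭ.eval x)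
        - 2 * 𝔘.eval x * (x * 𝔘.derivative.eval x - e * 𝔘.eval x) := by
    rw [hπ]
    simp only [derivative_sub, derivative_mul, derivative_pow, eval_add, eval_sub, eval_mul, eval_pow, eval_C, Nat.cast_ofNat,
      Nat.add_one_sub_one, pow_one]
    ring
  -- the square root: `S² = 4AC`, `R + U = S/2`, `R₂ + U = −S/2`
  set S := Real.sqrt ((τ.eval x) ^ 2 + 4 * 1 * π.eval x) with hSdef
  have hS2 : S ^ 2 = (τ.eval x) ^ 2 + 4 * 1 * π.eval x := Real.sq_sqrt hdisc
  have hS4 : S ^ 2 = 4 * (𝔄.eval x * ℭ.eval x) := by rw [hS2, hτx, hπx]; ring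
  have hRU : R + 𝔘.eval x = S / 2 := by rw [hR, hτx]; ring
  have hR₂U : R₂ + 𝔘.eval x = -(S / 2) := by rw [hR₂, hτx]; ring
  -- `Φ(x)` in raw form (normal-form `J`)
  have hraw := eval_criticalPoly_raw e !![(0 : ℝ), 1; 1, 0] τ π Φ (by rw [hΦ]; simp) x
  simp only [Matrix.of_apply, Matrix.cons_val', Matrix.cons_val_zero, Matrix.cons_val_one, Matrix.cons_val_fin_one,
    Matrix.empty_val'] at hraw
  -- the two signed sums of squares as quadratic forms of `G_e` along `(C, −(R+U))` and `(C, −(R₂+U))`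
  have hQ1 := quadForm_letters ((d₀ : ℝ) - e) ((d₁ : ℝ) - e) ((d₂ : ℝ) - e) ((d₃ : ℝ) - e) (w₀ * x ^ d₀) (w₁ * x ^ d₁) (w₂ * x ^ d₂)
    (w₃ * x ^ d₃) (v₀ 0) (v₀ 1) (v₁ 0) (v₁ 1) (v₂ 0) (v₂ 1) (v₃ 0) (v₃ 1) (ℭ.eval x) (-(R + 𝔘.eval x))
    (x * 𝔄.derivative.eval x - e * 𝔄.eval x) (x * 𝔘.derivative.eval x - e * 𝔘.eval x) (x * ℭ.derivative.eval x - e * ℭ.eval x)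
    (by rw [dA, eA]; ring) (by rw [dU, eU]; ring) (by rw [dC, eC]; ring)
  have hQ2 := quadForm_letters ((d₀ : ℝ) - e) ((d₁ : ℝ) - e) ((d₂ : ℝ) - e) ((d₃ : ℝ) - e) (w₀ * x ^ d₀) (w₁ * x ^ d₁) (w₂ * x ^ d₂)
    (w₃ * x ^ d₃) (v₀ 0) (v₀ 1) (v₁ 0) (v₁ 1) (v₂ 0) (v₂ 1) (v₃ 0) (v₃ 1) (ℭ.eval x) (-(R₂ + 𝔘.eval x))
    (x * 𝔄.derivative.eval x - e * 𝔄.eval x) (x * 𝔘.derivative.eval x - e * 𝔘.eval x) (x * ℭ.derivative.eval x - e * ℭ.eval x)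
    (by rw [dA, eA]; ring) (by rw [dU, eU]; ring) (by rw [dC, eC]; ring)
  have hs : ∀ (p q m : ℝ), p * ℭ.eval x + q * (-m) = p * ℭ.eval x - q * m := by intro p q m; ring
  simp only [hs] at hQ1 hQ2
  rw [← hQ1, ← hQ2, hraw, hτe, hπe, hτx, hπx, hRU, hR₂U]
  -- abstract algebra modulo `S² = 4AC`, all moment values atomic
  linear_combination (-((x * ℭ.derivative.eval x - e * ℭ.eval x) / 4
      * (2 * ℭ.eval x ^ 2 * (x * 𝔄.derivative.eval x - e * 𝔄.eval x) + (S ^ 2 + 4 * (𝔄.eval x * ℭ.eval x)) * (x * ℭ.derivative.eval x - e * ℭ.eval x) / 4)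
      - ℭ.eval x ^ 2 * (x * 𝔘.derivative.eval x - e * 𝔘.eval x) ^ 2)) * hS4

end Summit.ValiantsHypothesis.ValiantsHypothesis.Theorems.LacunarySymmetroidMatrixDescartes.Pivot.Resolvent
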